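import Summits.CriticalPhenomena.CardyFormulaZ2.Theorems.CardyComplexConeCoherentMoreraKirchhoffSignedHopf
import Summits.CriticalPhenomena.CardyFormulaZ2.Theorems.CardyComplexConeCoherentMoreraKirchhoffCycleWinding
import Literature.Probability.LatticeModels.PairIdentities

/-!
# The signed Umlaufsatz for cycles of the turning rule, in winding-number form
(helper for stub `stub_kirchhoff` of line `finitary-green-pairing`, crux `CoherentMorera`, stmt-CriticalPhenomena-11388)

For a cycle `L` of `nextCorner β` of minimal period `n + 1 ≥ 2` through `q`, with turning number
`T = ∑_{m ≤ n} turnSign β (orb m) ∈ {4, -4}` (`medialCycle_turning_holds`) and closed perturbed polygon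
`cyLoop n hP`, write `W v` for the winding number of the polygon around the lattice site `v`.  The
vertices of the corners of `L` all have the same `W` (consecutive corners share their vertex or are
joined by the followed OPEN edge, which the polygon misses).  **Dichotomy** (`cycle_dichotomy`):

* `T = -4 ⟹ W (orb m).1 = 0` for every `m` (the cycle runs clockwise around the dual cluster on its
  right; its primal vertices, on its left, are outside);
* `T = +4 ⟹ W (orb m).1 ≠ 0` for every `m` (counter-clockwise around the primal cluster on its left).

Proof: at a LOWEST vertex of the simple polygon `cycVert` (`isSimplePolygon_cycVert`) the exterior
angle is `(π/4)·turnSign` of the turn it belongs to, so by the signed Hopf Umlaufsatz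
(`signedHopf_lowest`) `T = 4·turnSign` there.  A face turn at the lowest vertex follows an open
HORIZONTAL edge lying `1/8` below it, whose endpoints — corner vertices of `L` — are strictly below the
whole polygon, hence have `W = 0`; a vertex turn at the lowest vertex crosses a closed VERTICAL edge
around its top endpoint `v` (a corner vertex), whose bottom endpoint `u` is strictly below the polygon
(`W u = 0`) and whose partner corner is off the cycle, so `W v ≠ W u` by the jump across a crossed edge
(`cycleWinding_jump`).
-/

noncomputable section

namespace Summit.CriticalPhenomena.CardyFormulaZ2.Cruxes.CoherentMorera.FinitaryGreenPairing

open Complex Set Literature.Topology.PlaneTopology Literature.Probability.LatticeModels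
open Literature.Probability.Percolation (BondConfig)

variable {β : BondConfig (Site 2)} {q : Site 2 × Fin 4}

/-! ### Imaginary parts of the shifted points -/

/-- `Im (I^k w)` for the four powers. -/
theorem im_I_pow_mul (k : Fin 4) (w : ℂ) :
    (I ^ (k : ℕ) * w).im = (![w.im, w.re, -w.im, -w.re] : Fin 4 → ℝ) k := by
  fin_cases k <;> simp [pow_succ, mul_im]

/-- `tPt p = sPt p + I^k (dT - dS)`. -/
theorem tPt_eq_sPt_add (p : Site 2 × Fin 4) : tPt p = sPt p + I ^ (p.2 : ℕ) * (dT - dS) := by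
  rw [tPt, sPt]; ring

/-- `I³ (dT - dS) = (1 + i)/4`. -/
theorem I_pow_three_mul_dT_sub_dS : I ^ 3 * (dT - dS) = ⟨1 / 4, 1 / 4⟩ := by
  apply Complex.ext <;> norm_num [pow_succ]

/-- `I (dT - dS) = -(1 + i)/4`. -/
theorem I_mul_dT_sub_dS : I * (dT - dS) = ⟨-(1 / 4), -(1 / 4)⟩ := by
  apply Complex.ext <;> norm_num

/-- Height of the source point: `Im (sPt (v,k)) = v₁ + Im (I^k dS)`. -/
theorem sPt_im (v : Site 2) (k : Fin 4) :
    (sPt (v, k)).im = (v 1 : ℝ) + (![(1:ℝ) / 8, 3 / 8, -(1 / 8), -(3 / 8)] : Fin 4 → ℝ) k := by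
  rw [sPt, add_im, Site.toComplex_im, im_I_pow_mul]
  fin_cases k <;> simp

/-- Height of the target point: `Im (tPt (v,k)) = v₁ + Im (I^k dT)`. -/
theorem tPt_im (v : Site 2) (k : Fin 4) :
    (tPt (v, k)).im = (v 1 : ℝ) + (![(3:ℝ) / 8, 1 / 8, -(3 / 8), -(1 / 8)] : Fin 4 → ℝ) k := by
  rw [tPt, add_im, Site.toComplex_im, im_I_pow_mul]
  fin_cases k <;> simp

/-- Height of the end of the face connector `v + I^k fE`. -/
theorem fE_im (v : Site 2) (k : Fin 4) :
    (Site.toComplex v + I ^ (k : ℕ) * fE).im = (v 1 : ℝ) + (![(5:ℝ) / 8, 1 / 8, -(5 / 8), -(1 / 8)] : Fin 4 → ℝ) k := by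
  rw [add_im, Site.toComplex_im, im_I_pow_mul]
  fin_cases k <;> simp

/-- Height of the end of the vertex connector `v + I^k vE`. -/
theorem vE_im (v : Site 2) (k : Fin 4) :
    (Site.toComplex v + I ^ (k : ℕ) * vE).im = (v 1 : ℝ) + (![(3:ℝ) / 8, -(1 / 8), -(3 / 8), 1 / 8] : Fin 4 → ℝ) k := by
  rw [add_im, Site.toComplex_im, im_I_pow_mul]
  fin_cases k <;> simp

/-- Height increment of the dart after a face turn: `Im (I^{k+3} (dT - dS))`. -/
theorem dart_after_face_im (k : Fin 4) :
    (I ^ ((k + 3 : Fin 4) : ℕ) * (dT - dS)).im = (![(1:ℝ) / 4, 1 / 4, -(1 / 4), -(1 / 4)] : Fin 4 → ℝ) k := by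
  rw [I_pow_fin_add, show ((3 : Fin 4) : ℕ) = 3 from rfl, mul_assoc, I_pow_three_mul_dT_sub_dS, im_I_pow_mul]

/-- Height increment of the dart after a vertex turn: `Im (I^{k+1} (dT - dS))`. -/
theorem dart_after_vertex_im (k : Fin 4) :
    (I ^ ((k + 1 : Fin 4) : ℕ) * (dT - dS)).im = (![-((1:ℝ) / 4), -(1 / 4), 1 / 4, 1 / 4] : Fin 4 → ℝ) k := by
  rw [I_pow_fin_add, show ((1 : Fin 4) : ℕ) = 1 from rfl, pow_one, mul_assoc, I_mul_dT_sub_dS, im_I_pow_mul]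
  fin_cases k <;> simp

/-- The second coordinate of the unit step `cornerUnit (k + 1)`. -/
theorem cornerUnit_succ_apply_one (k : Fin 4) : (cornerUnit (k + 1) 1 : ℤ) = (![1, 0, -1, 0] : Fin 4 → ℤ) k := by
  fin_cases k <;> rfl

/-- The height of the far endpoint `v + cornerUnit (k+1)` of the target edge of `(v, k)`. -/
theorem far_apply_one (v : Site 2) (k : Fin 4) :
    (((v + cornerUnit (k + 1)) 1 : ℤ) : ℝ) = (v 1 : ℝ) + (![(1:ℝ), 0, -1, 0] : Fin 4 → ℝ) k := by
  rw [Pi.add_apply, Int.cast_add, cornerUnit_succ_apply_one]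
  fin_cases k <;> simp

/-! ### The geometry of a lowest turn -/

/-- **A face turn at a lowest vertex follows a horizontal open edge `1/8` below it.**  If the turn of
the corner `r = (v, k)` is a face turn (`cTgt r ∈ β`) and one of the two polygon vertices of its
connector (`tPt r`, `sPt r'`, `r' = nextCorner β r`) has height `L` not exceeding those of `sPt r`,
`tPt r`, `sPt r'`, `tPt r'`, then `k = 1`: the followed edge `cTgt r = s(v, v - e₀)` is horizontal at
height `L - 1/8`. -/
theorem face_turn_lowest {r : Site 2 × Fin 4} (hk : cTgt r ∈ β) {L : ℝ}
    (hL : L = (tPt r).im ∨ L = (sPt (nextCorner β r)).im)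
    (h1 : L ≤ (sPt r).im) (h2 : L ≤ (tPt r).im) (h3 : L ≤ (sPt (nextCorner β r)).im)
    (h4 : L ≤ (tPt (nextCorner β r)).im) :
    ((r.1 1 : ℝ) = L - 1 / 8) ∧ r.2 = 1 := by
  obtain ⟨v, k⟩ := r
  have hs' := sPt_nextCorner_of_mem hk
  have ht' : tPt (nextCorner β (v, k)) = Site.toComplex v + I ^ (k : ℕ) * fE + I ^ ((k + 3 : Fin 4) : ℕ) * (dT - dS) := by
    rw [tPt_eq_sPt_add, hs', nextCorner_of_mem hk]
  rw [hs'] at hL h3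
  rw [ht', add_im, dart_after_face_im, fE_im] at h4
  rw [fE_im] at hL h3
  rw [sPt_im] at h1
  rw [tPt_im] at hL h2
  change ((v 1 : ℝ) = L - 1 / 8) ∧ k = 1
  fin_cases k <;> simp at hL h1 h2 h3 h4 <;> rcases hL with hL | hL <;> (try subst hL) <;>
    first | exact ⟨by linarith, rfl⟩ | (exfalso; linarith)

/-- **A vertex turn at a lowest vertex crosses a vertical closed edge around its top endpoint.**  With
the notation of `face_turn_lowest`, if the turn of `r = (v, k)` is a vertex turn (`cTgt r ∉ β`), then
`k = 2`: the crossed edge `cTgt r = s(v, v - e₁)` is vertical with top endpoint `v` at height `L + 3/8`. -/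
theorem vertex_turn_lowest {r : Site 2 × Fin 4} (hk : cTgt r ∉ β) {L : ℝ}
    (hL : L = (tPt r).im ∨ L = (sPt (nextCorner β r)).im)
    (h1 : L ≤ (sPt r).im) (h2 : L ≤ (tPt r).im) (h3 : L ≤ (sPt (nextCorner β r)).im)
    (h4 : L ≤ (tPt (nextCorner β r)).im) :
    ((r.1 1 : ℝ) = L + 3 / 8) ∧ r.2 = 2 := by
  obtain ⟨v, k⟩ := r
  have hs' := sPt_nextCorner_of_not_mem hk
  have ht' : tPt (nextCorner β (v, k)) = Site.toComplex v + I ^ (k : ℕ) * vE + I ^ ((k + 1 : Fin 4) : ℕ) * (dT - dS) := by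
    rw [tPt_eq_sPt_add, hs', nextCorner_of_not_mem hk]
  rw [hs'] at hL h3
  rw [ht', add_im, dart_after_vertex_im, vE_im] at h4
  rw [vE_im] at hL h3
  rw [sPt_im] at h1
  rw [tPt_im] at hL h2
  change ((v 1 : ℝ) = L + 3 / 8) ∧ k = 2
  fin_cases k <;> simp at hL h1 h2 h3 h4 <;> rcases hL with hL | hL <;> (try subst hL) <;>
    first | exact ⟨by linarith, rfl⟩ | (exfalso; linarith)

/-! ### Exterior angles of the perturbed polygon at single vertices -/

/-- The exterior angle at the target point `tPt (orb m)` (vertex `2m + 1`) is `(π/4)·turnSign`. -/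
theorem extAngle_cycVert_odd {Q : ℕ} (hP : cornerOrbit β q Q = q) (m : ℕ) :
    extAngle (cycVert β q Q) ((2 * m : ℕ) + 1) = Real.pi / 4 * turnSign β (cornerOrbit β q m) := by
  rw [extAngle, show ((2 * m : ℕ) : ℤ) + 1 + 1 = ((2 * m + 2 : ℕ) : ℤ) by push_cast; ring,
    show ((2 * m : ℕ) : ℤ) + 1 - 1 = ((2 * m : ℕ) : ℤ) by ring,
    show ((2 * m : ℕ) : ℤ) + 1 = ((2 * m + 1 : ℕ) : ℤ) by push_cast; ring,
    cycVert_natCast hP, cycVert_natCast hP, cycVert_natCast hP, pieceVert_odd_succ, pieceVert_odd, pieceVert_even]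
  exact arg_at_tPt _

/-- The exterior angle at the source point `sPt (orb (m+1))` (vertex `2m + 2`) is `(π/4)·turnSign`
of the turn of `orb m`. -/
theorem extAngle_cycVert_even_succ {Q : ℕ} (hP : cornerOrbit β q Q = q) (m : ℕ) :
    extAngle (cycVert β q Q) ((2 * m + 1 : ℕ) + 1) = Real.pi / 4 * turnSign β (cornerOrbit β q m) := by
  rw [extAngle, show ((2 * m + 1 : ℕ) : ℤ) + 1 + 1 = ((2 * m + 3 : ℕ) : ℤ) by push_cast; ring,
    show ((2 * m + 1 : ℕ) : ℤ) + 1 - 1 = ((2 * m + 1 : ℕ) : ℤ) by ring,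
    show ((2 * m + 1 : ℕ) : ℤ) + 1 = ((2 * m + 2 : ℕ) : ℤ) by push_cast; ring,
    cycVert_natCast hP, cycVert_natCast hP, cycVert_natCast hP, pieceVert_odd_succ_succ, pieceVert_odd_succ,
    pieceVert_odd]
  exact arg_at_sPt _

/-! ### The dichotomy -/

/-- All vertices of the corners of a cycle are joined by open edges (consecutive corners share
their vertex or span the followed open edge). -/
theorem reachable_fst_orb {n : ℕ} (hP : cornerOrbit β q (n + 1) = q) (a b : ℕ) :
    (Literature.Probability.Percolation.openGraph β).Reachable (cornerOrbit β q a).1 (cornerOrbit β q b).1 := by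
  have h := cornerOrbit_fst_reachable β q (show a ≤ b + a * (n + 1) by nlinarith)
  rwa [cornerOrbit_add_mul_period hP] at h

/-- **The signed Umlaufsatz for cycles of the turning rule, in winding-number form.**  For a cycle of
minimal period `n + 1 ≥ 2` of `nextCorner β` through `q` (`β` a set of lattice edges), with closed
perturbed polygon `cyLoop n hP`: if the turning number `∑ turnSign` is `-4`, every vertex of a corner of
the cycle has winding number `0`; if it is `+4`, every such vertex has non-zero winding number. -/
theorem cycle_dichotomy (hβ : β ⊆ (zdGraph 2).edgeSet) {n : ℕ} (hn : 1 ≤ n)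
    (hP : cornerOrbit β q (n + 1) = q) (hmin : ∀ s, 0 < s → s < n + 1 → cornerOrbit β q s ≠ q) :
    ((∑ m ∈ Finset.range (n + 1), turnSign β (cornerOrbit β q m)) = -4 →
        ∀ m, wind (fun t => (cyLoop n hP).extend t - Site.toComplex (cornerOrbit β q m).1) = 0) ∧
    ((∑ m ∈ Finset.range (n + 1), turnSign β (cornerOrbit β q m)) = 4 →
        ∀ m, wind (fun t => (cyLoop n hP).extend t - Site.toComplex (cornerOrbit β q m).1) ≠ 0) := by
  classical
  -- the simple polygon and a lowest vertex among the indices `1 … 2(n+1)`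
  have hsp : IsSimplePolygon (cycVert β q (n + 1)) (2 * (n + 1)) := isSimplePolygon_cycVert (by omega) hP hmin
  obtain ⟨j, hj, hjmin⟩ := (Finset.range (2 * (n + 1))).exists_min_image
    (fun j : ℕ => (pieceVert β q (j + 1)).im) ⟨0, by simp⟩
  rw [Finset.mem_range] at hj
  set L := (pieceVert β q (j + 1)).im with hLdef
  have hlowN : ∀ j' < 2 * (n + 1), L ≤ (pieceVert β q (j' + 1)).im := fun j' hj' =>
    hjmin j' (Finset.mem_range.2 hj')
  have hlow_nat : ∀ i : ℕ, L ≤ (pieceVert β q i).im := by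
    intro i
    rw [← pieceVert_mod hP i]
    have hlt : i % (2 * (n + 1)) < 2 * (n + 1) := Nat.mod_lt i (by omega)
    rcases Nat.eq_zero_or_pos (i % (2 * (n + 1))) with h0 | hpos
    · rw [h0, ← pieceVert_add_period hP 0, zero_add, show 2 * (n + 1) = (2 * (n + 1) - 1) + 1 by omega]
      exact hlowN _ (by omega)
    · have := hlowN (i % (2 * (n + 1)) - 1) (by omega)
      rwa [show i % (2 * (n + 1)) - 1 + 1 = i % (2 * (n + 1)) by omega] at this
  have hlowZ : ∀ i : ℤ, (cycVert β q (n + 1) ((j + 1 : ℕ) : ℤ)).im ≤ (cycVert β q (n + 1) i).im := by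
    intro i
    rw [cycVert_natCast hP]
    exact hlow_nat _
  -- the turn the lowest vertex belongs to
  set m := j / 2 with hmdef
  have hm : m ≤ n := by omega
  set r := cornerOrbit β q m with hrdef
  have hsum := sum_extAngle_cycVert (β := β) (q := q) hP
  have hext : extAngle (cycVert β q (n + 1)) ((j + 1 : ℕ) : ℤ) = Real.pi / 4 * turnSign β r := by
    rcases Nat.even_or_odd j with ⟨t, ht⟩ | ⟨t, ht⟩
    · have htm : t = m := by omega
      rw [show ((j + 1 : ℕ) : ℤ) = ((2 * t : ℕ) : ℤ) + 1 by push_cast; omega, extAngle_cycVert_odd hP, htm]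
    · have htm : t = m := by omega
      rw [show ((j + 1 : ℕ) : ℤ) = ((2 * t + 1 : ℕ) : ℤ) + 1 by push_cast; omega, extAngle_cycVert_even_succ hP, htm]
  obtain ⟨hpos, hneg⟩ := signedHopf_lowest (cycVert β q (n + 1)) (2 * (n + 1)) (j + 1) hsp hlowZ
  have hπ := Real.pi_pos
  -- the turning number is `4 · turnSign r`
  have hT : (∑ m ∈ Finset.range (n + 1), turnSign β (cornerOrbit β q m)) = 4 * turnSign β r := by
    by_cases hk : cTgt r ∈ β
    · have hs : turnSign β r = -1 := turnSign_of_mem hk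
      have hlt : extAngle (cycVert β q (n + 1)) ((j + 1 : ℕ) : ℤ) < 0 := by
        rw [hext, hs]; push_cast; linarith
      have h2 := hneg hlt
      rw [hsum] at h2
      have : (∑ m ∈ Finset.range (n + 1), (turnSign β (cornerOrbit β q m) : ℝ)) = -4 := by nlinarith
      rw [hs]; exact_mod_cast this
    · have hs : turnSign β r = 1 := turnSign_of_not_mem hk
      have hgt : 0 < extAngle (cycVert β q (n + 1)) ((j + 1 : ℕ) : ℤ) := by
        rw [hext, hs]; push_cast; linarith
      have h2 := hpos hgt
      rw [hsum] at h2
      have : (∑ m ∈ Finset.range (n + 1), (turnSign β (cornerOrbit β q m) : ℝ)) = 4 := by nlinarith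
      rw [hs]; exact_mod_cast this
  -- the four vertices around the lowest one
  have h1 : L ≤ (sPt r).im := by rw [hrdef, ← pieceVert_even]; exact hlow_nat _
  have h2 : L ≤ (tPt r).im := by rw [hrdef, ← pieceVert_odd]; exact hlow_nat _
  have h3 : L ≤ (sPt (nextCorner β r)).im := by rw [hrdef, ← pieceVert_odd_succ]; exact hlow_nat _
  have h4 : L ≤ (tPt (nextCorner β r)).im := by rw [hrdef, ← pieceVert_odd_succ_succ]; exact hlow_nat _
  have hL : L = (tPt r).im ∨ L = (sPt (nextCorner β r)).im := by
    rcases Nat.even_or_odd j with ⟨t, ht⟩ | ⟨t, ht⟩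
    · left; rw [hLdef, hrdef, show j + 1 = 2 * m + 1 by omega, pieceVert_odd]
    · right; rw [hLdef, hrdef, show j + 1 = 2 * m + 2 by omega, pieceVert_odd_succ]
  -- heights of the whole polygon
  have hrange : ∀ {b : ℝ}, b < L → ∀ z ∈ range (cyLoop n hP), b < z.im := by
    intro b hb z hz
    refine lt_im_of_mem_range_cyLoop hP (fun j' _ => ?_) (fun j' _ => ?_) hz
    · rw [cyS_eq_sPt, ← pieceVert_even]; exact lt_of_lt_of_le hb (hlow_nat _)
    · rw [cyT_eq_tPt, ← pieceVert_odd]; exact lt_of_lt_of_le hb (hlow_nat _)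
  have hW0 : ∀ {u : Site 2}, ((u 1 : ℤ) : ℝ) < L →
      wind (fun t => (cyLoop n hP).extend t - Site.toComplex u) = 0 := by
    intro u hu
    refine wind_cyLoop_eq_zero_of_im_ne hP fun z hz => ?_
    rw [Site.toComplex_im]
    exact (ne_of_gt (hrange hu z hz))
  have hall : ∀ m', wind (fun t => (cyLoop n hP).extend t - Site.toComplex (cornerOrbit β q m').1) =
      wind (fun t => (cyLoop n hP).extend t - Site.toComplex r.1) := fun m' =>
    wind_cyLoop_eq_of_reachable hβ hP (reachable_fst_orb hP m' m)
  refine ⟨fun hTneg m' => ?_, fun hTpos m' => ?_⟩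
  · -- `T = -4`: a face turn at the lowest vertex
    have hk : cTgt r ∈ β := by
      by_contra hk
      rw [hT, turnSign_of_not_mem hk] at hTneg; norm_num at hTneg
    obtain ⟨hv, -⟩ := face_turn_lowest hk hL h1 h2 h3 h4
    rw [hall m']
    exact hW0 (by rw [hv]; linarith)
  · -- `T = +4`: a vertex turn at the lowest vertex
    have hk : cTgt r ∉ β := by
      intro hk
      rw [hT, turnSign_of_mem hk] at hTpos; norm_num at hTpos
    obtain ⟨hv, hk2⟩ := vertex_turn_lowest hk hL h1 h2 h3 h4
    -- the partner corner `(v - e₁, 0)` and its heights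
    have hpart : cornerPartner r = (r.1 + cornerUnit 3, 0) := by
      rw [cornerPartner, hk2]; rfl
    have hu : ((((r.1 + cornerUnit 3) 1 : ℤ)) : ℝ) = L - 5 / 8 := by
      simp only [Pi.add_apply, Int.cast_add, cornerUnit]; simp; linarith
    have hp : (tPt (cornerPartner r)).im = L - 2 / 8 := by
      rw [hpart, tPt_im]; simp only [Pi.add_apply, Int.cast_add, cornerUnit]; simp; linarith
    have hLp : ∀ m'', cornerOrbit β q m'' ≠ cornerPartner r := by
      intro m'' hm''
      have := hlow_nat (2 * m'' + 1)
      rw [pieceVert_odd, hm'', hp] at this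
      linarith
    have hjump := cycleWinding_jump β q n hP hmin m hm hk hLp
    have hu0 : wind (fun t => (cyLoop n hP).extend t - Site.toComplex (cornerPartner r).1) = 0 :=
      hW0 (by rw [hpart]; linarith)
    rw [hall m']
    intro h0
    exact hjump (h0.trans hu0.symm)

/-- **Signed Umlaufsatz for cycles of the turning rule, registered form** (glue sub-goal
`cycleTurning_signed` of the line): for a cycle of minimal period `n + 1 ≥ 2` of `nextCorner β` through
`q` (`β` a set of lattice edges), turning number `-4` forces winding number `0` of the closed perturbed
polygon around every corner vertex of the cycle, and turning number `+4` forces non-zero winding number. -/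
theorem cycleTurning_signed : ∀ (β : BondConfig (Site 2)) (q : Site 2 × Fin 4) (n : ℕ)
    (hP : cornerOrbit β q (n + 1) = q), β ⊆ (zdGraph 2).edgeSet → 1 ≤ n →
    (∀ s, 0 < s → s < n + 1 → cornerOrbit β q s ≠ q) →
    ((∑ m ∈ Finset.range (n + 1), turnSign β (cornerOrbit β q m)) = -4 →
        ∀ m, wind (fun t => (cyLoop n hP).extend t - Site.toComplex (cornerOrbit β q m).1) = 0) ∧
    ((∑ m ∈ Finset.range (n + 1), turnSign β (cornerOrbit β q m)) = 4 →
        ∀ m, wind (fun t => (cyLoop n hP).extend t - Site.toComplex (cornerOrbit β q m).1) ≠ 0) :=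
  fun _ _ _ hP hβ hn hmin => cycle_dichotomy hβ hn hP hmin

end Summit.CriticalPhenomena.CardyFormulaZ2.Cruxes.CoherentMorera.FinitaryGreenPairing

end
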